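import Literature.AlgebraicTopology.Homotopy.RelativeHomotopyGroups
import Literature.AlgebraicTopology.Homotopy.WhiteheadCWContractible
import HarnessLib

/-!
# Collapsing `J ⊆ ∂Iⁿ` to a point: the two models of the relative homotopy groups

Topic `Literature/AlgebraicTopology/Homotopy` (Hatcher, *Algebraic Topology* (2002), §4.1,
p. 343; Spanier, *Algebraic Topology* (1966/1981), Ch. 7 §2 and §4, p. 391). Hatcher defines
`πₙ(X, A, x₀)` as homotopy classes of maps `(Iⁿ, ∂Iⁿ, Jⁿ⁻¹) → (X, A, x₀)` — the model of
`Literature.AlgebraicTopology.Homotopy.RelHomotopyGroup` (`RelativeHomotopyGroups.lean`, free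
face `{y 0 = 0}`, `J = RelGenLoop.jBoundary 0`) — and remarks (p. 343): "Observe that … the two
definitions [via `(Iⁿ, ∂Iⁿ, Jⁿ⁻¹)` and via `(Dⁿ, Sⁿ⁻¹, s₀)`] are equivalent since collapsing
`Jⁿ⁻¹` to a point converts `(Iⁿ, ∂Iⁿ, Jⁿ⁻¹)` into `(Dⁿ, Sⁿ⁻¹, s₀)`."  Spanier (Ch. 7 §4,
p. 391) uses the point model throughout the proof of the Hurewicz theorem ("maps
`α : (Δⁿ, Δ̇ⁿ) → (X, A)` such that `α(v₀) = x₀`", i.e. a single point of the boundary is sent to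
the base point), which is what makes the faces of a singular simplex again represent relative
homotopy classes.  This file supplies the geometric input of that equivalence for the cube
`Iᵐ⁺¹`, `m ≥ 1`, everything PROVED:

* `JCollapse.contractJ` — an explicit contraction of `J` *inside* `J` to the corner `0`
  (slide the walls `I × ∂Iᵐ` up into the lid `{y 0 = 1}`, shrink the lid to its corner
  `(1, 0, …, 0)`, slide that corner down the edge `{(s, 0, …, 0)} ⊆ J` to `0`);
* `JCollapse.collapse m : C(I × Iᵐ⁺¹, Iᵐ⁺¹)` — a deformation `D` of the cube with `D₀ = id`,
  `Dₜ(∂Iᵐ⁺¹) ⊆ ∂Iᵐ⁺¹`, `Dₜ(J) ⊆ J` and `D₁(J) = {0}` (`collapse_zero`, `collapse_mem_boundary`,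
  `collapse_mem_jBoundary`, `collapse_one_of_mem_jBoundary`), obtained from `contractJ` by two
  applications of the homotopy extension property in the form of the radial box filling
  `Literature.AlgebraicTopology.Homotopy.WhiteheadCW.boxFill` of `WhiteheadCWContractible.lean`
  (Hatcher Prop. 0.16): first over the free face `F = {y 0 = 0} ≅ Dᵐ` with values in `∂Iᵐ⁺¹`
  (the filling takes only values of its data, `boxFill_mem`), then over the whole cube;
* consequences for relative loops (`RelGenLoop 0 A a` on `Fin (m + 1)`): precomposition with
  `D₁` does not change the class (`RelGenLoop.homotopic_compCollapse`), and the **point model**: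
  a map of triples `g : (Iᵐ⁺¹, ∂Iᵐ⁺¹, 0) → (X, A, a)` (`JCollapse.PtLoop`) yields the relative
  loop `g ∘ D₁` (`PtLoop.toRel`), homotopies of maps of triples yield homotopies of relative loops
  (`PtLoop.homotopic_toRel`), a map with image in `A` yields the trivial class
  (`PtLoop.toRel_mk_eq_default`), and every class of `π_{m+1}(X, A, a)` arises this way, indeed
  from its own representatives (`RelHomotopyGroup.mk_toRel_self`).

The corner `0 ∈ J` is chosen because the homeomorphism of pairs `κ : (Iⁿ, ∂Iⁿ) ≅ (Δⁿ, ∂Δⁿ)` of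
`Literature/AlgebraicTopology/SingularHomology/HurewiczSimplexClass.lean` sends it to the vertex
`v₀` of `Δⁿ`, Spanier's base vertex.  Dimension one (`m = 0`, where `J = {1}` and nothing needs
collapsing) is excluded: `0 ∉ J` there.

## References

* A. Hatcher, *Algebraic Topology*, CUP (2002), §4.1, p. 343 (the two definitions of
  `πₙ(X, A, x₀)`), Prop. 0.16 (box filling / homotopy extension for `(Dⁿ, ∂Dⁿ)`). [HatcherAT2002]
* E. H. Spanier, *Algebraic Topology*, Springer (1981), Ch. 7 §4, p. 391. [Spanier1981]
-/

noncomputable section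

open Set Metric Function
open scoped unitInterval Topology

namespace Literature.AlgebraicTopology.Homotopy

namespace JCollapse

variable {m : ℕ}

/-! ### Coordinates on `Iᵐ⁺¹ = I × Iᵐ`: membership in `∂Iᵐ⁺¹` and in `J` -/

/-- `J = RelGenLoop.jBoundary 0 ⊆ Iᵐ⁺¹` in head/tail coordinates: the lid `{y 0 = 1}` and the
walls `{tail y ∈ ∂Iᵐ}`. [folklore] -/
theorem mem_jBoundary_iff (y : Fin (m + 1) → I) :
    y ∈ RelGenLoop.jBoundary (0 : Fin (m + 1)) ↔ y 0 = 1 ∨ Fin.tail y ∈ Cube.boundary (Fin m) := by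
  rw [RelGenLoop.mem_jBoundary]
  refine or_congr Iff.rfl ⟨?_, ?_⟩
  · rintro ⟨j, hj, h⟩
    refine ⟨j.pred hj, ?_⟩
    simpa [Fin.tail, Fin.succ_pred] using h
  · rintro ⟨i, hi⟩
    exact ⟨i.succ, Fin.succ_ne_zero i, hi⟩

/-- `Fin.cons s y' ∈ J` iff `s = 1` or `y' ∈ ∂Iᵐ`. [folklore] -/
theorem cons_mem_jBoundary_iff (s : I) (y' : Fin m → I) :
    (Fin.cons s y' : Fin (m + 1) → I) ∈ RelGenLoop.jBoundary (0 : Fin (m + 1)) ↔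
      s = 1 ∨ y' ∈ Cube.boundary (Fin m) := by
  rw [mem_jBoundary_iff, Fin.cons_zero, Fin.tail_cons]

/-- `∂Iᵐ⁺¹` in head/tail coordinates. [folklore] -/
theorem mem_boundary_iff (y : Fin (m + 1) → I) :
    y ∈ Cube.boundary (Fin (m + 1)) ↔ (y 0 = 0 ∨ y 0 = 1) ∨ Fin.tail y ∈ Cube.boundary (Fin m) := by
  rw [RelGenLoop.mem_boundary_iff (0 : Fin (m + 1)), mem_jBoundary_iff, or_assoc]

/-- `J ⊆ ∂Iᵐ⁺¹`. [folklore] -/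
theorem jBoundary_subset_boundary :
    RelGenLoop.jBoundary (0 : Fin (m + 1)) ⊆ Cube.boundary (Fin (m + 1)) :=
  RelGenLoop.jBoundary_subset_boundary 0

/-- The corner `0` lies in `J` as soon as `m ≥ 1` (its coordinate `1` vanishes). [folklore] -/
theorem zero_mem_jBoundary [NeZero m] : (0 : Fin (m + 1) → I) ∈ RelGenLoop.jBoundary (0 : Fin (m + 1)) :=
  (mem_jBoundary_iff 0).2 (Or.inr ⟨0, Or.inl rfl⟩)

/-- `J` is closed. [folklore] -/
theorem isClosed_jBoundary : IsClosed (RelGenLoop.jBoundary (0 : Fin (m + 1))) := by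
  have h : RelGenLoop.jBoundary (0 : Fin (m + 1)) =
      {y | y 0 = 1} ∪ ⋃ i : Fin m, ({y | y i.succ = 0} ∪ {y | y i.succ = 1}) := by
    ext y
    simp only [mem_jBoundary_iff, Cube.boundary, mem_union, mem_setOf_eq, mem_iUnion, Fin.tail]
  rw [h]
  refine (isClosed_eq (continuous_apply 0) continuous_const).union
    (isClosed_iUnion_of_finite fun i => ?_)
  exact (isClosed_eq (continuous_apply _) continuous_const).union
    (isClosed_eq (continuous_apply _) continuous_const)

/-! ### Stage maps and the contraction of `J` inside `J` -/

/-- The predicate "maps `J` into `J`" on self-maps of the cube. [folklore] -/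
def PJ : C((Fin (m + 1) → I), Fin (m + 1) → I) → Prop :=
  fun f => ∀ y ∈ RelGenLoop.jBoundary (0 : Fin (m + 1)), f y ∈ RelGenLoop.jBoundary (0 : Fin (m + 1))

/-- Raise the head coordinate: `s ↦ s + t (1 - s) = 1 - (1 - t)(1 - s)`. [folklore] -/
def raise (t s : I) : I :=
  ⟨(s : ℝ) + t * (1 - s),
    ⟨add_nonneg s.2.1 (mul_nonneg t.2.1 (sub_nonneg.2 s.2.2)), by
      nlinarith [s.2.1, s.2.2, t.2.1, t.2.2]⟩⟩

/-- The value of `raise`. [folklore] -/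
@[simp] theorem coe_raise (t s : I) : (raise t s : ℝ) = s + t * (1 - s) := rfl

/-- `raise` is continuous in both variables. [folklore] -/
theorem continuous_raise : Continuous fun p : I × I => raise p.1 p.2 :=
  Continuous.subtype_mk (by fun_prop) _

/-- At time `0` nothing is raised. [folklore] -/
@[simp] theorem raise_zero_left (s : I) : raise 0 s = s :=
  Subtype.ext (by simp)

/-- At time `1` the head coordinate is `1`. [folklore] -/
@[simp] theorem raise_one_left (s : I) : raise 1 s = 1 :=
  Subtype.ext (by simp)

/-- The lid (`s = 1`) is never moved. [folklore] -/
@[simp] theorem raise_one_right (t : I) : raise t 1 = 1 :=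
  Subtype.ext (by simp)

/-- Scale a coordinate: `y ↦ (1 - t) y`. [folklore] -/
def scale (t y : I) : I :=
  ⟨(1 - (t : ℝ)) * y, unitInterval.mul_mem ⟨sub_nonneg.2 t.2.2, by linarith [t.2.1]⟩ y.2⟩

/-- The value of `scale`. [folklore] -/
@[simp] theorem coe_scale (t y : I) : (scale t y : ℝ) = (1 - t) * y := rfl

/-- `scale` is continuous in both variables. [folklore] -/
theorem continuous_scale : Continuous fun p : I × I => scale p.1 p.2 :=
  Continuous.subtype_mk (by fun_prop) _

/-- At time `0` nothing is scaled. [folklore] -/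
@[simp] theorem scale_zero_left (y : I) : scale 0 y = y :=
  Subtype.ext (by simp)

/-- At time `1` the coordinate is `0`. [folklore] -/
@[simp] theorem scale_one_left (y : I) : scale 1 y = 0 :=
  Subtype.ext (by simp)

/-- The lid map `y ↦ (1, tail y)`. [folklore] -/
def toLid : C((Fin (m + 1) → I), Fin (m + 1) → I) where
  toFun y := Fin.cons 1 (Fin.tail y)
  continuous_toFun := Continuous.finCons continuous_const (continuous_id.finTail)

/-- The constant map to the corner `(1, 0, …, 0)` of the lid. [folklore] -/
def lidCorner : Fin (m + 1) → I := Fin.cons 1 0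

/-- **Stage A**: slide every point up towards the lid, `(s, y') ↦ (1 - (1-t)(1-s), y')`; the
lid is fixed and wall points stay on their wall, so `J` is preserved. [folklore] -/
def stageA : ContinuousMap.HomotopyWith (ContinuousMap.id (Fin (m + 1) → I)) toLid PJ where
  toFun p := Fin.cons (raise p.1 (p.2 0)) (Fin.tail p.2)
  continuous_toFun := Continuous.finCons
    (continuous_raise.comp (continuous_fst.prodMk ((continuous_apply 0).comp continuous_snd)))
    (continuous_snd.finTail)
  map_zero_left y := by simp
  map_one_left y := by simp [toLid]
  prop' t y hy := by
    change (Fin.cons (raise t (y 0)) (Fin.tail y) : Fin (m + 1) → I) ∈ _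
    rw [cons_mem_jBoundary_iff]
    rcases (mem_jBoundary_iff y).1 hy with h | h
    · left; rw [h, raise_one_right]
    · exact Or.inr h

/-- **Stage B**: shrink the lid linearly to its corner, `(1, y') ↦ (1, (1-t) y')` (after
stage A everything relevant sits in the lid, which lies in `J`). [folklore] -/
def stageB : ContinuousMap.HomotopyWith (toLid : C((Fin (m + 1) → I), Fin (m + 1) → I))
    (ContinuousMap.const _ lidCorner) PJ where
  toFun p := Fin.cons 1 fun i => scale p.1 (p.2 i.succ)
  continuous_toFun := Continuous.finCons continuous_const
    (continuous_pi fun i => continuous_scale.comp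
      (continuous_fst.prodMk ((continuous_apply i.succ).comp continuous_snd)))
  map_zero_left y := by
    change (Fin.cons 1 fun i => scale 0 (y i.succ) : Fin (m + 1) → I) = Fin.cons 1 (Fin.tail y)
    congr 1; funext i; simp [Fin.tail]
  map_one_left y := by
    change (Fin.cons 1 fun i => scale 1 (y i.succ) : Fin (m + 1) → I) = Fin.cons 1 0
    congr 1; funext i; simp
  prop' t y _ := by
    change (Fin.cons 1 fun i => scale t (y i.succ) : Fin (m + 1) → I) ∈ _
    rw [cons_mem_jBoundary_iff]
    exact Or.inl rfl

/-- **Stage C** (`m ≥ 1`): slide the lid corner down the edge `{(s, 0, …, 0)} ⊆ J` to `0`.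
[folklore] -/
def stageC [NeZero m] : ContinuousMap.HomotopyWith
    (ContinuousMap.const (Fin (m + 1) → I) lidCorner) (ContinuousMap.const _ 0) PJ where
  toFun p := Fin.cons (unitInterval.symm p.1) 0
  continuous_toFun := Continuous.finCons (unitInterval.continuous_symm.comp continuous_fst)
    continuous_const
  map_zero_left y := by
    change (Fin.cons (unitInterval.symm 0) 0 : Fin (m + 1) → I) = Fin.cons 1 0
    rw [unitInterval.symm_zero]
  map_one_left y := by
    change (Fin.cons (unitInterval.symm 1) 0 : Fin (m + 1) → I) = 0
    rw [unitInterval.symm_one]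
    funext i
    exact Fin.cases rfl (fun _ => rfl) i
  prop' t y _ := by
    change (Fin.cons (unitInterval.symm t) 0 : Fin (m + 1) → I) ∈ _
    rw [cons_mem_jBoundary_iff]
    exact Or.inr ⟨0, Or.inl rfl⟩

/-- **The contraction of `J` inside `J`**: a homotopy of self-maps of `Iᵐ⁺¹` (`m ≥ 1`) from the
identity to the constant map at the corner `0`, through maps sending `J` into `J` (only its
restriction to `J` matters: stages A, B, C). [folklore] -/
def contractJ [NeZero m] : ContinuousMap.HomotopyWith (ContinuousMap.id (Fin (m + 1) → I))
    (ContinuousMap.const _ 0) PJ :=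
  stageA.trans (stageB.trans stageC)

section

variable [NeZero m]

/-- The contraction starts at the identity. [folklore] -/
@[simp] theorem contractJ_zero (y : Fin (m + 1) → I) : contractJ (0, y) = y :=
  contractJ.map_zero_left y

/-- The contraction ends at the corner `0`. [folklore] -/
@[simp] theorem contractJ_one (y : Fin (m + 1) → I) : contractJ (1, y) = 0 :=
  contractJ.map_one_left y

/-- `contractJ` keeps `J` inside `J` at all times. [folklore] -/
theorem contractJ_mem_jBoundary (t : I) {y : Fin (m + 1) → I}
    (hy : y ∈ RelGenLoop.jBoundary (0 : Fin (m + 1))) :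
    contractJ (t, y) ∈ RelGenLoop.jBoundary (0 : Fin (m + 1)) :=
  contractJ.prop' t y hy

end

/-! ### The radial box filling takes only values of its data -/

/-- On the solid box `D × [0, τ]`, the values of `WhiteheadCW.boxFill τ φ h` are values of `φ` on
`D` or of `h` on `∂D × [0, τ]`; hence a property shared by these data passes to the filling.
[folklore] -/
theorem boxFill_mem {Y : Type*} {k : ℕ} {τ : ℝ} (hτ : 0 < τ) {φ : (Fin k → ℝ) → Y}
    {h : (Fin k → ℝ) × ℝ → Y} {S : Set Y}
    (hφ : ∀ w ∈ closedBall (0 : Fin k → ℝ) 1, φ w ∈ S)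
    (hh : ∀ w ∈ sphere (0 : Fin k → ℝ) 1, ∀ t ∈ Icc (0 : ℝ) τ, h (w, t) ∈ S)
    {w : Fin k → ℝ} (hw : w ∈ closedBall (0 : Fin k → ℝ) 1) {t : ℝ} (ht : t ∈ Icc (0 : ℝ) τ) :
    WhiteheadCW.boxFill τ φ h (w, t) ∈ S := by
  have hw1 : ‖w‖ ≤ 1 := mem_closedBall_zero_iff.1 hw
  have hpos : 0 < 2 * τ - t := by linarith [ht.2]
  unfold WhiteheadCW.boxFill
  dsimp only
  split_ifs with hc
  · apply hφ
    rw [mem_closedBall_zero_iff, norm_smul, Real.norm_eq_abs, abs_of_pos (div_pos (by positivity) hpos),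
      div_mul_eq_mul_div, div_le_one hpos]
    exact hc
  · have hc' : 2 * τ - t < 2 * τ * ‖w‖ := not_le.1 hc
    have hw0 : 0 < ‖w‖ := by
      rcases (norm_nonneg w).eq_or_lt with h0 | h0
      · rw [← h0, mul_zero] at hc'; linarith
      · exact h0
    apply hh
    · rw [mem_sphere_zero_iff_norm, norm_smul, norm_inv, norm_norm, inv_mul_cancel₀ hw0.ne']
    · constructor
      · rw [sub_nonneg, div_le_iff₀ hw0]; exact hc'.le
      · have h1 : 2 * τ - t ≤ (2 * τ - t) / ‖w‖ := by
          rw [le_div_iff₀ hw0]; nlinarith [ht.2]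
        linarith [ht.2]

/-! ### Sup-norm bookkeeping on `ℝᵐ⁺¹ = ℝ × ℝᵐ` and the cube/ball identifications -/

/-- `‖v‖ = max ‖v 0‖ ‖tail v‖` for the sup norm. [folklore] -/
theorem norm_eq_max (v : Fin (m + 1) → ℝ) : ‖v‖ = max ‖v 0‖ ‖Fin.tail v‖ := by
  apply le_antisymm
  · refine (pi_norm_le_iff_of_nonneg (by positivity)).2 fun i => ?_
    refine Fin.cases (le_max_left _ _) (fun j => ?_) i
    exact (norm_le_pi_norm (Fin.tail v) j).trans (le_max_right _ _)
  · exact max_le (norm_le_pi_norm v 0)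
      ((pi_norm_le_iff_of_nonneg (norm_nonneg _)).2 fun j => norm_le_pi_norm v j.succ)

/-- The tail of a point of the closed unit ball lies in the closed unit ball. [folklore] -/
theorem tail_mem_closedBall {v : Fin (m + 1) → ℝ} (hv : v ∈ closedBall (0 : Fin (m + 1) → ℝ) 1) :
    Fin.tail v ∈ closedBall (0 : Fin m → ℝ) 1 := by
  rw [mem_closedBall_zero_iff] at hv ⊢
  exact ((le_max_right _ _).trans_eq (norm_eq_max v).symm).trans hv

/-- `|v 0| ≤ 1` on the closed unit ball. [folklore] -/
theorem abs_head_le {v : Fin (m + 1) → ℝ} (hv : v ∈ closedBall (0 : Fin (m + 1) → ℝ) 1) :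
    |v 0| ≤ 1 := by
  rw [mem_closedBall_zero_iff] at hv
  exact (Real.norm_eq_abs _ ▸ norm_le_pi_norm v 0).trans hv

/-- On the unit sphere, `|v 0| = 1` or `‖tail v‖ = 1`. [folklore] -/
theorem abs_head_eq_one_or_of_mem_sphere {v : Fin (m + 1) → ℝ} (hv : v ∈ sphere (0 : Fin (m + 1) → ℝ) 1) :
    |v 0| = 1 ∨ ‖Fin.tail v‖ = 1 := by
  rw [mem_sphere_zero_iff_norm, norm_eq_max, Real.norm_eq_abs] at hv
  rcases le_total |v 0| ‖Fin.tail v‖ with h | h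
  · right; rwa [max_eq_right h] at hv
  · left; rwa [max_eq_left h] at hv

/-- `ballToCube ∘ cubeToBall = id`. [folklore] -/
@[simp] theorem ballToCube_cubeToBall {k : ℕ} (y : Fin k → I) :
    WhiteheadCW.ballToCube (WhiteheadCW.cubeToBall y) = y := by
  funext i
  have h : (WhiteheadCW.cubeToBall y i + 1) / 2 = (y i : ℝ) := by rw [WhiteheadCW.cubeToBall]; ring
  rw [WhiteheadCW.ballToCube, h, Set.projIcc_val]

/-- `cubeToBall` detects the boundary: `cubeToBall y ∈ ∂D` iff `y ∈ ∂Iᵏ`. [folklore] -/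
theorem cubeToBall_mem_sphere_iff {k : ℕ} (y : Fin k → I) :
    WhiteheadCW.cubeToBall y ∈ sphere (0 : Fin k → ℝ) 1 ↔ y ∈ Cube.boundary (Fin k) :=
  ⟨fun h => by simpa using WhiteheadCW.ballToCube_mem_boundary h, WhiteheadCW.cubeToBall_mem_sphere⟩

/-- Tails commute with `cubeToBall`. [folklore] -/
theorem tail_cubeToBall (y : Fin (m + 1) → I) :
    Fin.tail (WhiteheadCW.cubeToBall y) = WhiteheadCW.cubeToBall (Fin.tail y) := rfl

/-- Tails commute with `ballToCube`. [folklore] -/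
theorem tail_ballToCube (v : Fin (m + 1) → ℝ) :
    Fin.tail (WhiteheadCW.ballToCube v) = WhiteheadCW.ballToCube (Fin.tail v) := rfl

/-- The head of `cubeToBall y` is `2 y₀ - 1`. [folklore] -/
theorem cubeToBall_apply_zero (y : Fin (m + 1) → I) :
    WhiteheadCW.cubeToBall y 0 = 2 * (y 0 : ℝ) - 1 := rfl

/-- The head of `ballToCube v` vanishes when `v 0 ≤ -1`. [folklore] -/
theorem ballToCube_apply_zero_of_le {v : Fin (m + 1) → ℝ} (hv : v 0 ≤ -1) :
    WhiteheadCW.ballToCube v 0 = 0 := by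
  apply Subtype.ext
  rw [WhiteheadCW.ballToCube, Set.coe_projIcc]
  have : (v 0 + 1) / 2 ≤ 0 := by linarith
  simp [min_eq_right (this.trans zero_le_one), this]

/-- A point `v` of the closed ball with `1 ≤ v 0` or `1 ≤ ‖tail v‖` goes to `J` under
`ballToCube`. [folklore] -/
theorem ballToCube_mem_jBoundary {v : Fin (m + 1) → ℝ} (hv : v ∈ closedBall (0 : Fin (m + 1) → ℝ) 1)
    (h : 1 ≤ v 0 ∨ 1 ≤ ‖Fin.tail v‖) :
    WhiteheadCW.ballToCube v ∈ RelGenLoop.jBoundary (0 : Fin (m + 1)) := by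
  rw [mem_jBoundary_iff]
  rcases h with h | h
  · left
    have h1 : v 0 = 1 := le_antisymm ((le_abs_self _).trans (abs_head_le hv)) h
    apply Subtype.ext
    simp [WhiteheadCW.ballToCube, h1]
  · right
    rw [tail_ballToCube]
    apply WhiteheadCW.ballToCube_mem_boundary
    rw [mem_sphere_zero_iff_norm]
    exact le_antisymm (mem_closedBall_zero_iff.1 (tail_mem_closedBall hv)) h

/-- Conversely, for `y ∈ J` the point `cubeToBall y` satisfies `1 ≤ (cubeToBall y) 0` or
`1 ≤ ‖tail (cubeToBall y)‖`. [folklore] -/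
theorem one_le_or_of_mem_jBoundary {y : Fin (m + 1) → I} (hy : y ∈ RelGenLoop.jBoundary (0 : Fin (m + 1))) :
    1 ≤ WhiteheadCW.cubeToBall y 0 ∨ 1 ≤ ‖Fin.tail (WhiteheadCW.cubeToBall y)‖ := by
  rcases (mem_jBoundary_iff y).1 hy with h | h
  · left; rw [cubeToBall_apply_zero, h]; norm_num
  · right
    rw [tail_cubeToBall, mem_sphere_zero_iff_norm.1 (WhiteheadCW.cubeToBall_mem_sphere h)]

/-! ### Step 1: filling the box over the free face `F = {y 0 = 0} ≅ Dᵐ`, inside `∂Iᵐ⁺¹` -/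

variable (m)

/-- The free face in ball coordinates: `w ↦ (0, ballToCube w)`. [folklore] -/
def faceIncl (w : Fin m → ℝ) : Fin (m + 1) → I := Fin.cons 0 (WhiteheadCW.ballToCube w)

/-- Side data over `∂F ⊆ J`: the contraction `contractJ` followed along `∂F × [0, 1]`. [folklore] -/
def faceSide [NeZero m] (p : (Fin m → ℝ) × ℝ) : Fin (m + 1) → I :=
  contractJ (Set.projIcc (0 : ℝ) 1 zero_le_one p.2, faceIncl m p.1)

/-- **The filling over the free face**: `WhiteheadCW.boxFill` of `faceIncl` (bottom) and
`faceSide` (sides). [folklore] -/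
def faceFill [NeZero m] : (Fin m → ℝ) × ℝ → (Fin (m + 1) → I) :=
  WhiteheadCW.boxFill 1 (faceIncl m) (faceSide m)

variable {m}

/-- `faceIncl` is continuous. [folklore] -/
theorem continuous_faceIncl : Continuous (faceIncl m) :=
  Continuous.finCons continuous_const WhiteheadCW.continuous_ballToCube

/-- The head coordinate of `faceIncl w` is `0` (the free face). [folklore] -/
theorem faceIncl_apply_zero (w : Fin m → ℝ) : faceIncl m w 0 = 0 := by
  simp [faceIncl]

/-- The tail of `faceIncl w` is `ballToCube w`. [folklore] -/
theorem tail_faceIncl (w : Fin m → ℝ) : Fin.tail (faceIncl m w) = WhiteheadCW.ballToCube w := by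
  simp [faceIncl]

/-- `faceIncl` lands in the free face, hence in `∂Iᵐ⁺¹`. [folklore] -/
theorem faceIncl_mem_boundary (w : Fin m → ℝ) : faceIncl m w ∈ Cube.boundary (Fin (m + 1)) :=
  ⟨0, Or.inl (faceIncl_apply_zero w)⟩

/-- On `∂F` (ball coordinates: the sphere), `faceIncl` lands in `J`. [folklore] -/
theorem faceIncl_mem_jBoundary {w : Fin m → ℝ} (hw : w ∈ sphere (0 : Fin m → ℝ) 1) :
    faceIncl m w ∈ RelGenLoop.jBoundary (0 : Fin (m + 1)) := by
  rw [mem_jBoundary_iff, tail_faceIncl]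
  exact Or.inr (WhiteheadCW.ballToCube_mem_boundary hw)

/-- `faceIncl (cubeToBall y') = (0, y')`, i.e. the point `y` of the free face with tail `y'`.
[folklore] -/
theorem faceIncl_cubeToBall (y' : Fin m → I) :
    faceIncl m (WhiteheadCW.cubeToBall y') = Fin.cons 0 y' := by
  rw [faceIncl, ballToCube_cubeToBall]

section FaceFill

variable [NeZero m]

/-- `faceSide` is continuous. [folklore] -/
theorem continuous_faceSide : Continuous (faceSide m) :=
  contractJ.continuous.comp ((continuous_projIcc.comp continuous_snd).prodMk
    (continuous_faceIncl.comp continuous_fst))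

/-- At time `0` the side data are the free face. [folklore] -/
theorem faceSide_zero (w : Fin m → ℝ) : faceSide m (w, 0) = faceIncl m w := by
  simp [faceSide, Set.projIcc_left]

/-- The side data over `∂F` stay in `J`. [folklore] -/
theorem faceSide_mem_jBoundary {w : Fin m → ℝ} (hw : w ∈ sphere (0 : Fin m → ℝ) 1) (t : ℝ) :
    faceSide m (w, t) ∈ RelGenLoop.jBoundary (0 : Fin (m + 1)) :=
  contractJ_mem_jBoundary _ (faceIncl_mem_jBoundary hw)

/-- The filling over `F` is continuous on the solid box. [folklore] -/
theorem faceFill_continuousOn :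
    ContinuousOn (faceFill m) (closedBall (0 : Fin m → ℝ) 1 ×ˢ Icc (0 : ℝ) 1) :=
  WhiteheadCW.boxFill_continuousOn one_pos le_rfl continuous_faceIncl.continuousOn
    continuous_faceSide.continuousOn fun w _ => faceSide_zero w

/-- At time `0` the filling over `F` is the free face itself. [folklore] -/
theorem faceFill_zero {w : Fin m → ℝ} (hw : w ∈ closedBall (0 : Fin m → ℝ) 1) :
    faceFill m (w, 0) = faceIncl m w :=
  WhiteheadCW.boxFill_bottom one_pos hw

/-- Over `∂F` the filling is the contraction `contractJ`. [folklore] -/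
theorem faceFill_side {w : Fin m → ℝ} (hw : w ∈ sphere (0 : Fin m → ℝ) 1) {t : ℝ} (ht : t ∈ Icc (0 : ℝ) 1) :
    faceFill m (w, t) = faceSide m (w, t) :=
  WhiteheadCW.boxFill_side one_pos (fun w _ => faceSide_zero w) hw ht

/-- **The filling over `F` stays in `∂Iᵐ⁺¹`**: its data do (`F ⊆ ∂Iᵐ⁺¹`, `J ⊆ ∂Iᵐ⁺¹`). [folklore] -/
theorem faceFill_mem_boundary {w : Fin m → ℝ} (hw : w ∈ closedBall (0 : Fin m → ℝ) 1) {t : ℝ}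
    (ht : t ∈ Icc (0 : ℝ) 1) : faceFill m (w, t) ∈ Cube.boundary (Fin (m + 1)) :=
  boxFill_mem one_pos (S := Cube.boundary (Fin (m + 1))) (fun w _ => faceIncl_mem_boundary w)
    (fun _ hw' t _ => jBoundary_subset_boundary (faceSide_mem_jBoundary hw' t)) hw ht

end FaceFill

/-! ### Step 2: the deformation of `∂Iᵐ⁺¹` (side data of the big box) and the big filling -/

variable (m)

/-- Side data over `∂Iᵐ⁺¹` in ball coordinates: on `J` (`1 ≤ v 0` or `1 ≤ ‖tail v‖`) the
contraction `contractJ`, on the free face the filling `faceFill`. [folklore] -/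
def bigSide [NeZero m] (p : (Fin (m + 1) → ℝ) × ℝ) : Fin (m + 1) → I :=
  if 1 ≤ p.1 0 ∨ 1 ≤ ‖Fin.tail p.1‖ then
    contractJ (Set.projIcc (0 : ℝ) 1 zero_le_one p.2, WhiteheadCW.ballToCube p.1)
  else faceFill m (Fin.tail p.1, p.2)

/-- **The big filling**: `WhiteheadCW.boxFill` of `ballToCube` (bottom: the identity of the cube
in ball coordinates) and `bigSide`. [folklore] -/
def bigFill [NeZero m] : (Fin (m + 1) → ℝ) × ℝ → (Fin (m + 1) → I) :=
  WhiteheadCW.boxFill 1 WhiteheadCW.ballToCube (bigSide m)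

variable {m}

section BigFill

variable [NeZero m]

/-- On `J` the side data are the contraction. [folklore] -/
theorem bigSide_of_jBoundary {v : Fin (m + 1) → ℝ} (h : 1 ≤ v 0 ∨ 1 ≤ ‖Fin.tail v‖) (t : ℝ) :
    bigSide m (v, t) = contractJ (Set.projIcc (0 : ℝ) 1 zero_le_one t, WhiteheadCW.ballToCube v) :=
  if_pos h

/-- On the free face the side data are the filling over `F` (on `F ∩ J` the two recipes agree).
[folklore] -/
theorem bigSide_of_face {v : Fin (m + 1) → ℝ} (hv : v ∈ closedBall (0 : Fin (m + 1) → ℝ) 1)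
    (hv0 : v 0 ≤ -1) {t : ℝ} (ht : t ∈ Icc (0 : ℝ) 1) :
    bigSide m (v, t) = faceFill m (Fin.tail v, t) := by
  unfold bigSide
  dsimp only
  split_ifs with h
  · -- `v ∈ F ∩ J`: the tail is on the sphere, and the filling over `F` is the contraction there
    have h' : 1 ≤ ‖Fin.tail v‖ := by
      rcases h with h | h
      · exfalso; linarith
      · exact h
    have hsph : Fin.tail v ∈ sphere (0 : Fin m → ℝ) 1 :=
      mem_sphere_zero_iff_norm.2 (le_antisymm (mem_closedBall_zero_iff.1 (tail_mem_closedBall hv)) h')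
    rw [faceFill_side hsph ht, faceSide]
    congr 2
    funext i
    refine Fin.cases ?_ (fun j => ?_) i
    · rw [faceIncl_apply_zero, ballToCube_apply_zero_of_le hv0]
    · simp [faceIncl, WhiteheadCW.ballToCube, Fin.tail]
  · rfl

/-- The side data are continuous on `∂D × [0, 1]` (pasting along the closed cover
`{J, F}` of `∂Iᵐ⁺¹`). [folklore] -/
theorem bigSide_continuousOn :
    ContinuousOn (bigSide m) (sphere (0 : Fin (m + 1) → ℝ) 1 ×ˢ Icc (0 : ℝ) 1) := by
  set SJ : Set ((Fin (m + 1) → ℝ) × ℝ) :=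
    sphere (0 : Fin (m + 1) → ℝ) 1 ×ˢ Icc (0 : ℝ) 1 ∩ {p | 1 ≤ p.1 0 ∨ 1 ≤ ‖Fin.tail p.1‖} with hSJ
  set SF : Set ((Fin (m + 1) → ℝ) × ℝ) :=
    sphere (0 : Fin (m + 1) → ℝ) 1 ×ˢ Icc (0 : ℝ) 1 ∩ {p | p.1 0 ≤ -1} with hSF
  have hcover : sphere (0 : Fin (m + 1) → ℝ) 1 ×ˢ Icc (0 : ℝ) 1 = SJ ∪ SF := by
    ext ⟨v, t⟩
    simp only [hSJ, hSF, mem_union, mem_inter_iff, mem_setOf_eq]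
    constructor
    · intro hp
      rcases abs_head_eq_one_or_of_mem_sphere hp.1 with h | h
      · rcases (abs_eq zero_le_one).1 h with h | h
        · exact Or.inl ⟨hp, Or.inl h.ge⟩
        · exact Or.inr ⟨hp, h.le⟩
      · exact Or.inl ⟨hp, Or.inr h.ge⟩
    · rintro (⟨hp, -⟩ | ⟨hp, -⟩) <;> exact hp
  have hclosed : IsClosed (sphere (0 : Fin (m + 1) → ℝ) 1 ×ˢ Icc (0 : ℝ) 1) :=
    isClosed_sphere.prod isClosed_Icc
  have hSJc : IsClosed SJ := by
    refine hclosed.inter (IsClosed.union ?_ ?_)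
    · exact isClosed_le continuous_const ((continuous_apply 0).comp continuous_fst)
    · exact isClosed_le continuous_const (continuous_norm.comp (continuous_fst.finTail))
  have hSFc : IsClosed SF :=
    hclosed.inter (isClosed_le ((continuous_apply 0).comp continuous_fst) continuous_const)
  rw [hcover]
  refine ContinuousOn.union_of_isClosed ?_ ?_ hSJc hSFc
  · -- on `J`: the contraction
    have hc : Continuous fun p : (Fin (m + 1) → ℝ) × ℝ =>
        contractJ (Set.projIcc (0 : ℝ) 1 zero_le_one p.2, WhiteheadCW.ballToCube p.1) :=
      contractJ.continuous.comp ((continuous_projIcc.comp continuous_snd).prodMk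
        (WhiteheadCW.continuous_ballToCube.comp continuous_fst))
    refine hc.continuousOn.congr ?_
    rintro ⟨v, t⟩ ⟨-, h⟩
    exact bigSide_of_jBoundary h t
  · -- on `F`: the filling over the free face
    have hc : ContinuousOn (fun p : (Fin (m + 1) → ℝ) × ℝ => faceFill m (Fin.tail p.1, p.2)) SF := by
      refine faceFill_continuousOn.comp (continuous_fst.finTail.prodMk continuous_snd).continuousOn ?_
      rintro ⟨v, t⟩ ⟨⟨hv, ht⟩, -⟩
      exact ⟨tail_mem_closedBall (sphere_subset_closedBall hv), ht⟩
    refine hc.congr ?_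
    rintro ⟨v, t⟩ ⟨⟨hv, ht⟩, hv0⟩
    exact bigSide_of_face (sphere_subset_closedBall hv) hv0 ht

/-- At time `0` the side data are the identity (in ball coordinates). [folklore] -/
theorem bigSide_zero {v : Fin (m + 1) → ℝ} (hv : v ∈ sphere (0 : Fin (m + 1) → ℝ) 1) :
    bigSide m (v, 0) = WhiteheadCW.ballToCube v := by
  by_cases h : 1 ≤ v 0 ∨ 1 ≤ ‖Fin.tail v‖
  · rw [bigSide_of_jBoundary h, Set.projIcc_left]
    exact contractJ_zero (m := m) _
  · have hv' := sphere_subset_closedBall hv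
    have hv0 : v 0 ≤ -1 := by
      rcases abs_head_eq_one_or_of_mem_sphere hv with h1 | h1
      · rcases (abs_eq zero_le_one).1 h1 with h1 | h1
        · exact absurd (Or.inl h1.ge) h
        · exact h1.le
      · exact absurd (Or.inr h1.ge) h
    rw [bigSide_of_face hv' hv0 ⟨le_rfl, zero_le_one⟩, faceFill_zero (tail_mem_closedBall hv')]
    funext i
    refine Fin.cases ?_ (fun j => ?_) i
    · rw [faceIncl_apply_zero, ballToCube_apply_zero_of_le hv0]
    · simp [faceIncl, WhiteheadCW.ballToCube, Fin.tail]

/-- **The side data stay in `∂Iᵐ⁺¹`.** [folklore] -/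
theorem bigSide_mem_boundary {v : Fin (m + 1) → ℝ} (hv : v ∈ sphere (0 : Fin (m + 1) → ℝ) 1) {t : ℝ}
    (ht : t ∈ Icc (0 : ℝ) 1) : bigSide m (v, t) ∈ Cube.boundary (Fin (m + 1)) := by
  by_cases h : 1 ≤ v 0 ∨ 1 ≤ ‖Fin.tail v‖
  · rw [bigSide_of_jBoundary h]
    exact jBoundary_subset_boundary
      (contractJ_mem_jBoundary _ (ballToCube_mem_jBoundary (sphere_subset_closedBall hv) h))
  · have hv' := sphere_subset_closedBall hv
    have hv0 : v 0 ≤ -1 := by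
      rcases abs_head_eq_one_or_of_mem_sphere hv with h1 | h1
      · rcases (abs_eq zero_le_one).1 h1 with h1 | h1
        · exact absurd (Or.inl h1.ge) h
        · exact h1.le
      · exact absurd (Or.inr h1.ge) h
    rw [bigSide_of_face hv' hv0 ht]
    exact faceFill_mem_boundary (tail_mem_closedBall hv') ht

/-- **On `J` the side data stay in `J`.** [folklore] -/
theorem bigSide_mem_jBoundary {v : Fin (m + 1) → ℝ} (hv : v ∈ closedBall (0 : Fin (m + 1) → ℝ) 1)
    (h : 1 ≤ v 0 ∨ 1 ≤ ‖Fin.tail v‖) (t : ℝ) :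
    bigSide m (v, t) ∈ RelGenLoop.jBoundary (0 : Fin (m + 1)) := by
  rw [bigSide_of_jBoundary h]
  exact contractJ_mem_jBoundary _ (ballToCube_mem_jBoundary hv h)

/-- The big filling is continuous on the solid box. [folklore] -/
theorem bigFill_continuousOn :
    ContinuousOn (bigFill m) (closedBall (0 : Fin (m + 1) → ℝ) 1 ×ˢ Icc (0 : ℝ) 1) :=
  WhiteheadCW.boxFill_continuousOn one_pos le_rfl WhiteheadCW.continuous_ballToCube.continuousOn
    bigSide_continuousOn fun _ hv => bigSide_zero hv

/-- At time `0` the big filling is the identity (in ball coordinates). [folklore] -/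
theorem bigFill_zero {v : Fin (m + 1) → ℝ} (hv : v ∈ closedBall (0 : Fin (m + 1) → ℝ) 1) :
    bigFill m (v, 0) = WhiteheadCW.ballToCube v :=
  WhiteheadCW.boxFill_bottom one_pos hv

/-- Over `∂D` the big filling is `bigSide`. [folklore] -/
theorem bigFill_side {v : Fin (m + 1) → ℝ} (hv : v ∈ sphere (0 : Fin (m + 1) → ℝ) 1) {t : ℝ}
    (ht : t ∈ Icc (0 : ℝ) 1) : bigFill m (v, t) = bigSide m (v, t) :=
  WhiteheadCW.boxFill_side one_pos (fun _ hv => bigSide_zero hv) hv ht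

end BigFill

/-! ### The collapse `D : I × Iᵐ⁺¹ → Iᵐ⁺¹` -/

variable (m) in
/-- **The collapse of `J`**: a deformation `D` of the cube `Iᵐ⁺¹` (`m ≥ 1`) with `D₀ = id`,
`Dₜ(∂Iᵐ⁺¹) ⊆ ∂Iᵐ⁺¹`, `Dₜ(J) ⊆ J` and `D₁(J) = {0}` (Hatcher 2002, p. 343: "collapsing `Jⁿ⁻¹` to a
point converts `(Iⁿ, ∂Iⁿ, Jⁿ⁻¹)` into `(Dⁿ, Sⁿ⁻¹, s₀)`"; here realised as the end of a deformation
through maps of triples `(Iⁿ, ∂Iⁿ, J) → (Iⁿ, ∂Iⁿ, J)`). [cite: HatcherAT2002, §4.1 p. 343] -/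
def collapse [NeZero m] : C(I × (Fin (m + 1) → I), Fin (m + 1) → I) where
  toFun p := bigFill m (WhiteheadCW.cubeToBall p.2, p.1)
  continuous_toFun :=
    bigFill_continuousOn.comp_continuous
      ((WhiteheadCW.continuous_cubeToBall.comp continuous_snd).prodMk
        (continuous_subtype_val.comp continuous_fst))
      fun p => ⟨WhiteheadCW.cubeToBall_mem_closedBall p.2, p.1.2⟩

section Collapse

variable [NeZero m]

/-- `D₀ = id`. [folklore] -/
@[simp] theorem collapse_zero (y : Fin (m + 1) → I) : collapse m (0, y) = y := by
  change bigFill m (WhiteheadCW.cubeToBall y, 0) = y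
  rw [bigFill_zero (WhiteheadCW.cubeToBall_mem_closedBall y), ballToCube_cubeToBall]

/-- On the boundary, `D` is the deformation `bigSide` of `∂Iᵐ⁺¹`. [folklore] -/
theorem collapse_of_mem_boundary (t : I) {y : Fin (m + 1) → I} (hy : y ∈ Cube.boundary (Fin (m + 1))) :
    collapse m (t, y) = bigSide m (WhiteheadCW.cubeToBall y, t) :=
  bigFill_side (WhiteheadCW.cubeToBall_mem_sphere hy) t.2

/-- **`Dₜ(∂Iᵐ⁺¹) ⊆ ∂Iᵐ⁺¹`.** [folklore] -/
theorem collapse_mem_boundary (t : I) {y : Fin (m + 1) → I} (hy : y ∈ Cube.boundary (Fin (m + 1))) :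
    collapse m (t, y) ∈ Cube.boundary (Fin (m + 1)) := by
  rw [collapse_of_mem_boundary t hy]
  exact bigSide_mem_boundary (WhiteheadCW.cubeToBall_mem_sphere hy) t.2

/-- On `J`, `D` is the contraction `contractJ`. [folklore] -/
theorem collapse_of_mem_jBoundary (t : I) {y : Fin (m + 1) → I}
    (hy : y ∈ RelGenLoop.jBoundary (0 : Fin (m + 1))) : collapse m (t, y) = contractJ (t, y) := by
  rw [collapse_of_mem_boundary t (jBoundary_subset_boundary hy),
    bigSide_of_jBoundary (one_le_or_of_mem_jBoundary hy), ballToCube_cubeToBall, Set.projIcc_val]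

/-- **`Dₜ(J) ⊆ J`.** [folklore] -/
theorem collapse_mem_jBoundary (t : I) {y : Fin (m + 1) → I}
    (hy : y ∈ RelGenLoop.jBoundary (0 : Fin (m + 1))) :
    collapse m (t, y) ∈ RelGenLoop.jBoundary (0 : Fin (m + 1)) := by
  rw [collapse_of_mem_jBoundary t hy]
  exact contractJ_mem_jBoundary t hy

/-- **`D₁(J) = {0}`.** [folklore] -/
@[simp] theorem collapse_one_of_mem_jBoundary {y : Fin (m + 1) → I}
    (hy : y ∈ RelGenLoop.jBoundary (0 : Fin (m + 1))) : collapse m (1, y) = 0 := by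
  rw [collapse_of_mem_jBoundary 1 hy, contractJ_one]

/-- The free face is sent into the boundary: `y 0 = 0 → Dₜ y ∈ ∂Iᵐ⁺¹`. [folklore] -/
theorem collapse_mem_boundary_of_apply_zero (t : I) {y : Fin (m + 1) → I} (hy : y 0 = 0) :
    collapse m (t, y) ∈ Cube.boundary (Fin (m + 1)) :=
  collapse_mem_boundary t ⟨0, Or.inl hy⟩

/-- The time-`t` slice `Dₜ` as a continuous self-map of the cube. [folklore] -/
def collapseAt (t : I) : C((Fin (m + 1) → I), Fin (m + 1) → I) :=
  ⟨fun y => collapse m (t, y), (collapse m).continuous.comp (by fun_prop)⟩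

/-- Unfolding of `collapseAt`. [folklore] -/
@[simp] theorem collapseAt_apply (t : I) (y : Fin (m + 1) → I) : collapseAt t y = collapse m (t, y) := rfl

end Collapse

end JCollapse

/-! ### Consequences for relative loops and the point model -/

section RelLoops

open JCollapse

variable {m : ℕ} [NeZero m] {X : Type*} [TopologicalSpace X] {A : Set X} {a : A}

namespace RelGenLoop

/-- Precomposition of a relative loop `(Iᵐ⁺¹, ∂Iᵐ⁺¹, J) → (X, A, a)` with the slice `Dₜ` of the
collapse is again a relative loop (`Dₜ` is a map of triples). [folklore] -/
def compCollapse (f : RelGenLoop (0 : Fin (m + 1)) A a) (t : I) : RelGenLoop (0 : Fin (m + 1)) A a :=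
  ⟨(f : C((Fin (m + 1) → I), X)).comp (collapseAt t),
    fun _ hy => apply_mem_of_mem_boundary f (collapse_mem_boundary_of_apply_zero t hy),
    fun _ hy => apply_of_mem_jBoundary f (collapse_mem_jBoundary t hy)⟩

/-- `compCollapse f t` is `f ∘ Dₜ` pointwise. [folklore] -/
@[simp] theorem compCollapse_apply (f : RelGenLoop (0 : Fin (m + 1)) A a) (t : I) (y : Fin (m + 1) → I) :
    compCollapse f t y = f (collapse m (t, y)) := rfl

/-- `f ∘ D₀ = f`. [folklore] -/
theorem compCollapse_zero (f : RelGenLoop (0 : Fin (m + 1)) A a) : compCollapse f 0 = f :=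
  RelGenLoop.ext _ _ fun y => by simp

/-- **Precomposition with the collapse does not change the relative homotopy class**: `f ≃ f ∘ D₁`
through relative loops, by `(t, y) ↦ f (Dₜ y)`. [folklore] -/
theorem homotopic_compCollapse (f : RelGenLoop (0 : Fin (m + 1)) A a) (t₁ : I) :
    Homotopic f (compCollapse f t₁) := by
  refine ⟨{ toFun := fun p => f (collapse m (⟨(p.1 : ℝ) * t₁, unitInterval.mul_mem p.1.2 t₁.2⟩, p.2))
            continuous_toFun := ?_
            map_zero_left := fun y => ?_
            map_one_left := fun y => ?_
            prop' := fun t => ⟨fun y hy => ?_, fun y hy => ?_⟩ }⟩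
  · exact (f : C((Fin (m + 1) → I), X)).continuous.comp ((collapse m).continuous.comp
      (Continuous.prodMk (Continuous.subtype_mk (by fun_prop) _) continuous_snd))
  · simp only [Set.Icc.coe_zero, zero_mul]
    change f (collapse m (0, y)) = f y
    rw [collapse_zero]
  · simp only [Set.Icc.coe_one, one_mul]
    rfl
  · exact apply_mem_of_mem_boundary f (collapse_mem_boundary_of_apply_zero _ hy)
  · exact apply_of_mem_jBoundary f (collapse_mem_jBoundary _ hy)

end RelGenLoop

/-- The class of `f ∘ D₁` is the class of `f`. [folklore] -/
theorem RelHomotopyGroup.mk_compCollapse (f : RelGenLoop (0 : Fin (m + 1)) A a) (t : I) :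
    (⟦RelGenLoop.compCollapse f t⟧ : RelHomotopyGroup (0 : Fin (m + 1)) X A a) = ⟦f⟧ :=
  Quotient.sound (RelGenLoop.homotopic_compCollapse f t).symm

namespace JCollapse

variable (m A a) in
/-- **The point model**: maps of triples `(Iᵐ⁺¹, ∂Iᵐ⁺¹, 0) → (X, A, a)` — the boundary goes into
`A` and only the corner `0` is required to go to the base point (Hatcher 2002, p. 343, the
`(Dⁿ, Sⁿ⁻¹, s₀)` description; Spanier 1981, Ch. 7 §4 p. 391, "`α : (Δⁿ, Δ̇ⁿ) → (X, A)` such that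
`α(v₀) = x₀`"). [cite: HatcherAT2002, §4.1 p. 343] -/
def PtLoop : Set C((Fin (m + 1) → I), X) :=
  {g | (∀ y ∈ Cube.boundary (Fin (m + 1)), g y ∈ A) ∧ g 0 = a}

namespace PtLoop

/-- A relative loop is a map of triples `(Iᵐ⁺¹, ∂Iᵐ⁺¹, 0) → (X, A, a)` (`0 ∈ J`). [folklore] -/
theorem coe_mem (f : RelGenLoop (0 : Fin (m + 1)) A a) : (f : C((Fin (m + 1) → I), X)) ∈ PtLoop m A a :=
  ⟨fun _ hy => RelGenLoop.apply_mem_of_mem_boundary f hy,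
    RelGenLoop.apply_of_mem_jBoundary f zero_mem_jBoundary⟩

/-- **From the point model to the `J`-model**: `g ↦ g ∘ D₁`, a relative loop since
`D₁(∂Iᵐ⁺¹) ⊆ ∂Iᵐ⁺¹ ↦ A` and `D₁(J) = {0} ↦ a`. [cite: HatcherAT2002, §4.1 p. 343] -/
def toRel (g : C((Fin (m + 1) → I), X)) (hg : g ∈ PtLoop m A a) : RelGenLoop (0 : Fin (m + 1)) A a :=
  ⟨g.comp (collapseAt 1),
    fun y hy => hg.1 _ (collapse_mem_boundary_of_apply_zero 1 hy),
    fun y hy => by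
      change g (collapse m (1, y)) = a
      rw [collapse_one_of_mem_jBoundary hy, hg.2]⟩

/-- `toRel g` is `g ∘ D₁` pointwise. [folklore] -/
@[simp] theorem toRel_apply (g : C((Fin (m + 1) → I), X)) (hg : g ∈ PtLoop m A a) (y : Fin (m + 1) → I) :
    toRel g hg y = g (collapse m (1, y)) := rfl

/-- `toRel` only depends on the map. [folklore] -/
theorem toRel_congr {g g' : C((Fin (m + 1) → I), X)} (h : g = g') (hg : g ∈ PtLoop m A a)
    (hg' : g' ∈ PtLoop m A a) : toRel g hg = toRel g' hg' := by
  subst h; rfl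

/-- **Homotopies of maps of triples give homotopies of relative loops** after `∘ D₁`. [folklore] -/
theorem homotopic_toRel {g g' : C((Fin (m + 1) → I), X)} (hg : g ∈ PtLoop m A a) (hg' : g' ∈ PtLoop m A a)
    (H : g.HomotopyWith g' fun k => k ∈ PtLoop m A a) :
    RelGenLoop.Homotopic (toRel g hg) (toRel g' hg') := by
  refine ⟨{ toFun := fun p => H (p.1, collapse m (1, p.2))
            continuous_toFun := H.continuous.comp (continuous_fst.prodMk
              ((collapse m).continuous.comp (continuous_const.prodMk continuous_snd)))
            map_zero_left := fun y => by simp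
            map_one_left := fun y => by simp
            prop' := fun t => ⟨fun y hy => ?_, fun y hy => ?_⟩ }⟩
  · exact (H.prop' t).1 _ (collapse_mem_boundary_of_apply_zero 1 hy)
  · change H (t, collapse m (1, y)) = a
    rw [collapse_one_of_mem_jBoundary hy]
    exact (H.prop' t).2

/-- For a relative loop `f`, `toRel f = f ∘ D₁ = compCollapse f 1`. [folklore] -/
theorem toRel_coe (f : RelGenLoop (0 : Fin (m + 1)) A a) :
    toRel (f : C((Fin (m + 1) → I), X)) (coe_mem f) = RelGenLoop.compCollapse f 1 := rfl

/-- **A map of triples with image in `A` gives the trivial class** (compression, easy half).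
[cite: HatcherAT2002, §4.1 p. 343] -/
theorem toRel_mk_eq_default {g : C((Fin (m + 1) → I), X)} (hg : g ∈ PtLoop m A a) (hA : ∀ y, g y ∈ A) :
    (⟦toRel g hg⟧ : RelHomotopyGroup (0 : Fin (m + 1)) X A a) = default :=
  (RelHomotopyGroup.mk_eq_default_iff _).2
    (RelGenLoop.homotopic_const_of_forall_mem _ fun _ => hA _)

end PtLoop

end JCollapse

/-- **Every class of `π_{m+1}(X, A, a)` is represented, in the point model, by any of its own
representatives**: `⟦toRel f⟧ = ⟦f⟧` (Hatcher 2002, p. 343: the two definitions of the relative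
homotopy groups agree). [cite: HatcherAT2002, §4.1 p. 343] -/
theorem RelHomotopyGroup.mk_toRel_self (f : RelGenLoop (0 : Fin (m + 1)) A a) :
    (⟦JCollapse.PtLoop.toRel (f : C((Fin (m + 1) → I), X)) (JCollapse.PtLoop.coe_mem f)⟧ :
      RelHomotopyGroup (0 : Fin (m + 1)) X A a) = ⟦f⟧ := by
  rw [JCollapse.PtLoop.toRel_coe, RelHomotopyGroup.mk_compCollapse]

/-- **Surjectivity of the point model**: every element of `π_{m+1}(X, A, a)` is `⟦g ∘ D₁⟧` for a
map of triples `g : (Iᵐ⁺¹, ∂Iᵐ⁺¹, 0) → (X, A, a)`. [cite: HatcherAT2002, §4.1 p. 343] -/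
theorem RelHomotopyGroup.exists_toRel_eq (c : RelHomotopyGroup (0 : Fin (m + 1)) X A a) :
    ∃ (g : C((Fin (m + 1) → I), X)) (hg : g ∈ JCollapse.PtLoop m A a), ⟦JCollapse.PtLoop.toRel g hg⟧ = c := by
  induction c using Quotient.inductionOn with
  | h f => exact ⟨f, JCollapse.PtLoop.coe_mem f, RelHomotopyGroup.mk_toRel_self f⟩

end RelLoops

end Literature.AlgebraicTopology.Homotopy

end
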